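import Summits.ResolutionOfSingularities.ResolutionOfSingularities.Theorems.WeightedInvariantContactCylinderTorusFactorFlatT
import Summits.ResolutionOfSingularities.ResolutionOfSingularities.Theorems.WeightedInvariantIota3EpsTorus
import Summits.ResolutionOfSingularities.ResolutionOfSingularities.Theorems.WeightedInvariantIota3TauStrat
import Summits.ResolutionOfSingularities.ResolutionOfSingularities.Theorems.WeightedInvariantStratumIffOfStrat
import Summits.ResolutionOfSingularities.ResolutionOfSingularities.Theorems.WeightedInvariantIotaOrdEpsTauUpperSemicontinuousLE
import Mathlib.RingTheory.KrullDimension.Polynomial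
import HarnessLib

/-!
# (c10)≤3 for `ι₃ᵗ = Iota3.iotaFlatT`: BOTH τ-inputs `h10τ`, `hgenτ` of `Iota3.iotaFlatT_torusFactorMonotoneLE` follow from the ONE clause
# (c11τ)≤3 «τ is compatible with essentially smooth local homomorphisms into dimension ≤ 3» (door `HypersurfaceCentreConstruction`,
# stmt-ResolutionOfSingularities-19897; P3 rung `stub_keyRungGrHomLE_three`, gaps hc10 / hc11)

Topic: `Summits/ResolutionOfSingularities/ResolutionOfSingularities/Theorems`. Helper for the door item `HypersurfaceCentreConstruction`
(stmt-ResolutionOfSingularities-19897, route `WeightedInvariant`), line `local-engine`, def-free.  `Iota3.iotaFlatT_torusFactorMonotoneLE` (p541814,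
…ContactCylinderTorusFactorFlatT) gives the gap hc10 `IotaTorusFactorMonotoneLE 3 p iotaFlatT` MODULO three named inputs `h10τ` ((c10) for
`ι₃ᵘ = (ν ; ε ; τ)` at the torus points `T[X]_𝔮`, `𝔮` over `𝔪_T`, `dim T ≤ 3`), `hgenτ` (the generic-fibre equality `ι₃ᵘ(T(X)) = ι₃ᵘ(T)`) and `hσ`.
THIS FILE derives `h10τ` AND `hgenτ` from the single τ-clause that is also the τ-input `hτ`/`hτpt` of the (c11)≤3 assembly `jFlatT_map`
(…JFlatEssSmoothAssembly):

  (c11τ)≤3  `∀ T → T'` local, formally smooth, essentially of finite type, regular local, `dim T' ≤ 3`: `τ(T', φ g) = τ(T, g)`.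

* `Iota3.iotaTau_torusFactor_le_of_tauEssSmooth` — `τ(S[X]_𝔮, g) ≤ τ(S, g)` for EVERY prime `𝔮 ⊂ S[X]` over `𝔪_S` (the target may have
  dimension `4`: a tie generisation `(S[X]_𝔮)_𝔔 ≅ S[X]_Q ≅ S_𝔭[X]_{𝔮₁}` has dimension `3`, (c11τ)≤3 along `S_𝔭 → S_𝔭[X]_{𝔮₁}` gives `τ(S_𝔭) = 1`,
  and (c7τ) `τ(S_𝔭) ≤ τ(S)`);
* `Iota3.iotaOrdEpsTau_torusFactor_le_of_tauEssSmooth` = `h10τ` ((ν ; ε) is KEPT at torus points, `iotaOrdEps_torusFactor_eq`);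
* `Iota3.iotaOrdEpsTau_genericFibre_eq_of_tauEssSmooth` = `hgenτ` (`dim S(X) = dim S`, Mathlib `Polynomial.height_map_C`);
* **`Iota3.iotaFlatT_torusFactorMonotoneLE_of_tauEssSmooth`** — hc10 ⟸ (c11τ)≤3 ∧ `hσ` (the σ generic-fibre inequality).

So the τ-content of the gaps hc10 and hc11 of `keyRungGrHomLE_three_of_residue_at_powers'` is ONE statement, (c11τ)≤3.
[OURS · L1 W4.3 · (o44)/(o49)/(o53)]  Replaces the role of NO printed item; NOT a statement of the manuscript under review
[claim: Hironaka2017, status: under-review]; candidates stay candidates; AI work, weaker than expert review.  No definition; no axiom; (c11τ)≤3 and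
`hσ` are hypotheses of the line, not facts.

## References

* H. Matsumura, *Commutative Ring Theory* (1986), Thm. 4.3 (localisation of localisations), §15 (dimension of polynomial fibres),
  Thm. 19.5. [Matsumura1987]
-/

noncomputable section

open IsLocalRing Literature.AlgebraicGeometry.Resolution Polynomial
open Summit.ResolutionOfSingularities.ResolutionOfSingularities.Theorems
open Summit.ResolutionOfSingularities.ResolutionOfSingularities.Theorems.ContactCylinder

set_option linter.dupNamespace false -- mandated namespace of this single-conjunct summit

namespace Summit.ResolutionOfSingularities.ResolutionOfSingularities.Cruxes.HypersurfaceCentreConstruction.LocalEngine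

namespace Iota3

section TauTorus

variable
  (hτ : ∀ (T T' : Type) [CommRing T] [IsRegularLocalRing T] [CommRing T'] [IsRegularLocalRing T'] [Algebra T T']
    [IsLocalHom (algebraMap T T')] [Algebra.FormallySmooth T T'] [Algebra.EssFiniteType T T'] (g : T),
    ringKrullDim T' ≤ 3 → iotaTau T' (algebraMap T T' g) = iotaTau T g)
include hτ

/-- **τ DOES NOT INCREASE ALONG `S → S[X]_𝔮`, from (c11τ)≤3**: `τ(S[X]_𝔮, g) ≤ τ(S, g)` for `S` regular local, every `g`, EVERY prime
`𝔮 ⊂ S[X]` (not only those over `𝔪_S`; no dimension hypothesis: a tie generisation of the target has dimension `3` by definition, and is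
read on `S_𝔭[X]_{𝔮₁}` with `𝔭 = 𝔮₁ ∩ S`, where (c11τ)≤3 and (c7τ) apply). [OURS · (c10τ) ⟸ (c11τ)≤3] -/
theorem iotaTau_torusFactor_le_of_tauEssSmooth (S : Type) [CommRing S] [IsRegularLocalRing S] (f : S) (𝔮 : Ideal S[X]) [𝔮.IsPrime] :
    iotaTau (Localization.AtPrime 𝔮) (algebraMap S[X] (Localization.AtPrime 𝔮) (C f)) ≤ iotaTau S f := by
  rcases iotaTau_eq_zero_or_eq_one (Localization.AtPrime 𝔮) (algebraMap S[X] (Localization.AtPrime 𝔮) (C f)) with h0 | h1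
  · rw [h0]; exact zero_le
  rw [h1]
  -- a tie generisation `(S[X]_𝔮)_𝔔`
  obtain ⟨𝔔, htie⟩ := (iotaTau_eq_one_iff_exists _ _).mp h1
  have hdim𝔔 : ringKrullDim (Localization.AtPrime 𝔔.asIdeal) = 3 := ringKrullDim_eq_three_of_isTiePosition htie
  have hτ𝔔 : iotaTau (Localization.AtPrime 𝔔.asIdeal) (algebraMap (Localization.AtPrime 𝔮) (Localization.AtPrime 𝔔.asIdeal)
      (algebraMap S[X] (Localization.AtPrime 𝔮) (C f))) = 1 := iotaTau_of_isTiePosition htie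
  -- read on `S[X]_Q`, `Q = 𝔔 ∩ S[X]`
  obtain ⟨Q, hQ⟩ : ∃ Q : Ideal S[X], Q = 𝔔.asIdeal.comap (algebraMap S[X] (Localization.AtPrime 𝔮)) := ⟨_, rfl⟩
  haveI hQp : Q.IsPrime := by rw [hQ]; infer_instance
  have hτQ : iotaTau (Localization.AtPrime Q) (algebraMap S[X] (Localization.AtPrime Q) (C f)) = 1 := by
    rw [← hτ𝔔, StratumIff.iota_localization_localization_eq iotaTau iotaTau_isoInvariant 𝔮 𝔔.asIdeal (C f)]
    exact StratumIff.iota_localization_congr iotaTau hQ (C f)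
  have hdimQ : ringKrullDim (Localization.AtPrime Q) = 3 := by
    have e := (IsLocalization.localizationLocalizationAtPrimeIsoLocalization 𝔮.primeCompl 𝔔.asIdeal).toRingEquiv
    have h := ringKrullDim_eq_of_ringEquiv e
    rw [hdim𝔔] at h
    rw [TieFinite.ringKrullDim_atPrime_congr hQ, ← h]
  -- read on `S_𝔭[X]_{𝔮₁}`, `𝔭 = Q ∩ S`
  obtain ⟨𝔮₁, h𝔮₁p, h𝔮₁, -, Φ, hΦ⟩ := exists_ringEquiv_atPrime_polynomial S f Q (Q.comap (C : S →+* S[X])) rfl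
  haveI := h𝔮₁p
  have hτ₁ : iotaTau (Localization.AtPrime 𝔮₁) (algebraMap (Localization.AtPrime (Q.comap (C : S →+* S[X])))[X]
      (Localization.AtPrime 𝔮₁) (C (algebraMap S (Localization.AtPrime (Q.comap (C : S →+* S[X]))) f))) = 1 := by
    rw [← hΦ, iota_ringEquiv_atPrime Q 𝔮₁ iotaTau_isoInvariant Φ, hτQ]
  have hdim₁ : ringKrullDim (Localization.AtPrime 𝔮₁) ≤ 3 := by
    rw [← ringKrullDim_eq_of_ringEquiv Φ, hdimQ]
  -- (c11τ)≤3 along `S_𝔭 → S_𝔭[X]_{𝔮₁}`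
  set S𝔭 := Localization.AtPrime (Q.comap (C : S →+* S[X])) with hS𝔭
  haveI : IsRegularLocalRing S𝔭 := isRegularLocalRing_localization_atPrime S _
  haveI := isRegularLocalRing_localization_polynomial S𝔭 𝔮₁
  haveI := isLocalHom_algebraMap_localization_polynomial S𝔭 𝔮₁ h𝔮₁
  haveI := formallySmooth_localization_polynomial S𝔭 𝔮₁
  haveI := essFiniteType_localization_polynomial S𝔭 𝔮₁
  have hτ𝔭 : iotaTau S𝔭 (algebraMap S S𝔭 f) = 1 := by
    rw [← hτ S𝔭 (Localization.AtPrime 𝔮₁) (algebraMap S S𝔭 f) hdim₁,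
      IsScalarTower.algebraMap_apply S𝔭 S𝔭[X] (Localization.AtPrime 𝔮₁), Polynomial.algebraMap_eq, hτ₁]
  -- (c7τ): `τ(S_𝔭) ≤ τ(S)`
  rw [← hτ𝔭]
  exact iotaTau_localization_le _ f

/-- **`h10τ` FROM (c11τ)≤3**: `ι₃ᵘ(S[X]_𝔮, g) ≤ ι₃ᵘ(S, g)` for `S` regular local of Krull dimension `≤ 3`, every `g`, every prime `𝔮 ⊂ S[X]`
over `𝔪_S` — `(ν ; ε)` is kept (`iotaOrdEps_torusFactor_eq`) and `τ` does not increase. [OURS · (c10) for ι₃ᵘ ⟸ (c11τ)≤3] -/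
theorem iotaOrdEpsTau_torusFactor_le_of_tauEssSmooth (S : Type) [CommRing S] [IsRegularLocalRing S] (f : S)
    (𝔮 : Ideal S[X]) [𝔮.IsPrime] (_hdim : ringKrullDim S ≤ 3) (h𝔮 : 𝔮.comap (C : S →+* S[X]) = maximalIdeal S) :
    iotaOrdEpsTau (Localization.AtPrime 𝔮) (algebraMap S[X] (Localization.AtPrime 𝔮) (C f)) ≤ iotaOrdEpsTau S f := by
  rw [iotaOrdEpsTau_le_iff]
  exact Or.inr ⟨iotaOrdEps_torusFactor_eq S 𝔮 h𝔮 f, iotaTau_torusFactor_le_of_tauEssSmooth hτ S f 𝔮⟩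

/-- **`hgenτ` FROM (c11τ)≤3**: the generic-fibre equality `ι₃ᵘ(S(X), g) = ι₃ᵘ(S, g)`, `S(X) = S[X]_{𝔪_S S[X]}`, for `S` regular local of
Krull dimension `≤ 3` (`dim S(X) = dim S`, Mathlib `Polynomial.height_map_C`). [OURS · (c10) for ι₃ᵘ ⟸ (c11τ)≤3] -/
theorem iotaOrdEpsTau_genericFibre_eq_of_tauEssSmooth (S : Type) [CommRing S] [IsRegularLocalRing S] (f : S)
    [((maximalIdeal S).map (C : S →+* S[X])).IsPrime] (hdim : ringKrullDim S ≤ 3) :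
    iotaOrdEpsTau (Localization.AtPrime ((maximalIdeal S).map (C : S →+* S[X])))
        (algebraMap S[X] (Localization.AtPrime ((maximalIdeal S).map (C : S →+* S[X]))) (C f)) = iotaOrdEpsTau S f := by
  have h𝔮 : ((maximalIdeal S).map (C : S →+* S[X])).comap (C : S →+* S[X]) = maximalIdeal S :=
    ((maximalIdeal.isMaximal S).eq_of_le Ideal.IsPrime.ne_top' Ideal.le_comap_map).symm
  -- `dim S(X) = dim S ≤ 3`
  have hdimX : ringKrullDim (Localization.AtPrime ((maximalIdeal S).map (C : S →+* S[X]))) ≤ 3 := by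
    rw [IsLocalization.AtPrime.ringKrullDim_eq_height ((maximalIdeal S).map (C : S →+* S[X]))
      (Localization.AtPrime ((maximalIdeal S).map (C : S →+* S[X]))), Polynomial.height_map_C,
      IsLocalRing.maximalIdeal_height_eq_ringKrullDim]
    exact hdim
  haveI := isRegularLocalRing_localization_polynomial S ((maximalIdeal S).map (C : S →+* S[X]))
  haveI := isLocalHom_algebraMap_localization_polynomial S ((maximalIdeal S).map (C : S →+* S[X])) h𝔮
  haveI := formallySmooth_localization_polynomial S ((maximalIdeal S).map (C : S →+* S[X]))
  haveI := essFiniteType_localization_polynomial S ((maximalIdeal S).map (C : S →+* S[X]))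
  have hτX := hτ S (Localization.AtPrime ((maximalIdeal S).map (C : S →+* S[X]))) f hdimX
  rw [IsScalarTower.algebraMap_apply S S[X] (Localization.AtPrime ((maximalIdeal S).map (C : S →+* S[X]))),
    Polynomial.algebraMap_eq] at hτX
  rw [iotaOrdEpsTau_eq_iff]
  exact ⟨iotaOrdEps_torusFactor_eq S _ h𝔮 f, hτX⟩

/-- **THE GAP hc10 OF THE P3 RUNG MODULO (c11τ)≤3 AND `hσ`**: `IotaTorusFactorMonotoneLE 3 p Iota3.iotaFlatT` for every `p`, from the single
τ-clause (c11τ)≤3 (supplying both `h10τ` and `hgenτ` of `iotaFlatT_torusFactorMonotoneLE`) and the σ generic-fibre inequality `hσ`.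
[OURS · hc10 ⟸ (c11τ)≤3 ∧ hσ] -/
theorem iotaFlatT_torusFactorMonotoneLE_of_tauEssSmooth
    (hσ : ∀ (T : Type) [CommRing T] [IsRegularLocalRing T] (g : T)
      [((maximalIdeal T).map (C : T →+* T[X])).IsPrime], ringKrullDim T ≤ 3 →
      iotaSigma (Localization.AtPrime ((maximalIdeal T).map (C : T →+* T[X])))
        (algebraMap T[X] (Localization.AtPrime ((maximalIdeal T).map (C : T →+* T[X]))) (C g)) ≤ iotaSigma T g)
    (p : ℕ) : IotaTorusFactorMonotoneLE 3 p iotaFlatT :=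
  iotaFlatT_torusFactorMonotoneLE
    (fun T _ _ g 𝔮₁ _ hd h𝔮₁ => iotaOrdEpsTau_torusFactor_le_of_tauEssSmooth hτ T g 𝔮₁ hd h𝔮₁)
    (fun T _ _ g _ hd => iotaOrdEpsTau_genericFibre_eq_of_tauEssSmooth hτ T g hd) hσ p

end TauTorus

end Iota3

end Summit.ResolutionOfSingularities.ResolutionOfSingularities.Cruxes.HypersurfaceCentreConstruction.LocalEngine

end
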